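/-
Copyright (c) 2026 the pub-hodgecm-mathlib formalisation cell (harness21).  Prover seat hodgecm-mathlib-K2Liu-p09 (g3): Track B «K2-LIT», #184♮ = hLiu418,
payer-internal organ O1 «MAJORANT» of file #34 `Theorems/K2LiuDoublingZetaGL1.lean` (LEAD F0P6-plan (g10) DEAL K2/STATUS 2026-09-04T02:36:29Z; REPORT-FIRST
#34 v3, K2/K2Liu-p09/g3).
-/
import Summits.HodgeConjecture.HodgeConjecture.Theorems.K2LiuSiegelEisensteinDoubledSummable          -- ★ #9 + `parabolicIntegral` (E5′)
import Summits.HodgeConjecture.HodgeConjecture.Theorems.K2LiuSiegelEisensteinMajorantLocallyBounded   -- ★ `tsum_enorm_translate_le_on_compact`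
import Summits.HodgeConjecture.HodgeConjecture.Theorems.K2LiuSiegelDoubledHeightSmear               -- ★ `upper_bound_of_floor`
import Summits.HodgeConjecture.HodgeConjecture.Theorems.K2LiuDoublingUnfoldTwist                    -- ★ `iotaV_diag_iotaA_mem_ratH`, `ιA` continuous
import Summits.HodgeConjecture.HodgeConjecture.Theorems.K2LiuDoublingUnfoldOrbit                    -- ★ `iotaLeft_iotaA_mem_ratH`
import Summits.HodgeConjecture.HodgeConjecture.Theorems.K2LiuDoublingUnfoldEngine                   -- ★ `measurable_of_comp_mk_prod`
import Literature.NumberTheory.Automorphic.AdelicUnitaryGroupDatum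
import Literature.NumberTheory.Automorphic.UnitaryGroupOfFormAdelicTopology
import Literature.MeasureTheory.Group.QuotientAveraging
import Mathlib.MeasureTheory.Measure.Haar.Basic
import HarnessLib

/-!
# Crux `HLiu418`, Track B road `K2_Liu`, file #34 — organ O1 «THE EISENSTEIN MAJORANT ON `[G] × [G]` IS INTEGRABLE»

Cell `hodgecm-mathlib`, crux item hLiu418 = `stmt-HodgeConjecture-24832`, route of record `HCCMUnconditional`; squad K2 ∕ K2Liu, prover K2Liu-p09 (g3).
THEOREMS ONLY (no `def`, no instance, no notation, no named-fact hypothesis, no `sorry`, default heartbeats); lane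
`--supports stmt-HodgeConjecture-24832 --as helper` (count-neutral).

★ #13 `K2LiuDoublingUnfold.doublingUnfold` (and its `L²` form ★ `K2LiuDoublingZetaGL1Unfold.doublingUnfold_ae_twist`) carries ONE analytic binder the
payer of s23 must discharge: the `μ ⊗ μ`-integrability on `[G] × [G]` of the pulled-back Eisenstein MAJORANT `E(‖f‖)(ι(ιA x̃₁⁻¹, ιA x̃₂⁻¹))` times
`‖φ₁(x₁)‖ ‖φ₂(x₂)‖`.  On the COMPACT quotient `[G]` of #184♮ this is automatic for `Re s > n/2`, continuous `φᵢ` and a continuous Siegel section `f`: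
* §1 `tsum_norm_translate_le_on_compact` — the majorant `h ↦ Σ_{γ ∈ P_Δ(L⁺)\H(L⁺)} ‖f(γ h)‖` is BOUNDED ON COMPACTA of `H(𝔸)` (★
  `K2LiuSiegelEisensteinMajorantLocallyBounded.tsum_enorm_translate_le_on_compact` with its Godement data discharged exactly as in ★
  `K2LiuIntertwiningConvergesOfParabolic`: Haar measure on `H(𝔸)`, ★ Iwasawa datum, ★ continuous height, ★ `P_Δ(L⁺)`-weight, and Godement's
  parabolic integral ★ `K2LiuSiegelEisensteinDoubledSummable.parabolicIntegral`);
* §2 `tsum_norm_translate_ratH_mul` ∕ `measurable_tsum_norm_translate` — it is left-`H(L⁺)`-invariant (re-indexing, no convergence) and Borel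
  measurable (a countable `ℝ≥0∞`-sum of continuous functions, read back in `ℝ`);
* §3 `integrable_majorant_mul` — **THE BINDER**: on `[G]²` the kernel `x ↦ E(‖f‖)(ι(ιA x̃₁⁻¹, ιA x̃₂⁻¹))` is bounded (every class has a representative
  in a fixed compact set, ★ `WeilQuotient.exists_isCompact_image_mk_superset`; left-invariance moves `Quotient.out` to it) and measurable (its lift to
  `G × G` is `E(‖f‖) ∘ ι ∘ (ιA × ιA) ∘ inv`, ★ `K2LiuDoublingUnfoldEngine.measurable_of_comp_mk_prod`), and `μ ⊗ μ` is finite.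

HONEST LABEL: HC_CM is proved only modulo the printed citations (2 remaining named inputs: hLiu418 = stmt-HodgeConjecture-24832,
h413 = stmt-HodgeConjecture-24833) until rung 0 closes; this file is bookkeeping toward socket s23 and closes no item.

References: [MoeglinWaldspurger1995] II.1.5 (Eisenstein series converge uniformly on compacta); [Liu2021] Lem. B.10 (2), Lem. B.11 p. 102;
[GelbartPiatetskishapiroRallis1987] Part A §2.
-/

set_option autoImplicit false
set_option linter.dupNamespace false

noncomputable section

open scoped Matrix ENNReal NNReal ComplexConjugate
open NumberField IsDedekindDomain MeasureTheory Measure Set Filter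

namespace Summit.HodgeConjecture.HodgeConjecture.Cruxes.HLiu418.K2LiuDoublingZetaGL1Majorant

open Literature.NumberTheory.Automorphic Literature.NumberTheory.GaloisRepresentations
open Literature.NumberTheory.GelbartRogawski1991 Literature.NumberTheory.GelbartRogawski1991.GRConstruction
open Literature.NumberTheory.K2Lit.SiegelDoubled
open Literature.NumberTheory.Automorphic.UnitaryGroup (adelicGroupData adelicVal)
open Literature.MeasureTheory.Group
open Summit.HodgeConjecture.HodgeConjecture.Cruxes.HLiu418.K2LiuSiegelEisensteinDoubledSummableReduction
open Summit.HodgeConjecture.HodgeConjecture.Cruxes.HLiu418.K2LiuIwasawaDatumNonempty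
open Summit.HodgeConjecture.HodgeConjecture.Cruxes.HLiu418.K2LiuSiegelDoubledHeightSmear
open Summit.HodgeConjecture.HodgeConjecture.Cruxes.HLiu418.K2LiuSiegelDoubledUnfold
open Summit.HodgeConjecture.HodgeConjecture.Cruxes.HLiu418.K2LiuSiegelDoubledParabolicReduction
open Summit.HodgeConjecture.HodgeConjecture.Cruxes.HLiu418.K2LiuSiegelDeltaHeightExists
open Summit.HodgeConjecture.HodgeConjecture.Cruxes.HLiu418.K2LiuSiegelEisensteinMajorantLocallyBounded
open Summit.HodgeConjecture.HodgeConjecture.Cruxes.HLiu418.K2LiuSiegelEisensteinDoubledSummable (parabolicIntegral siegelEisensteinDoubledSummable)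
open Summit.HodgeConjecture.HodgeConjecture.Cruxes.HLiu418.K2LiuSiegelEisensteinDoubledLeftInvariant (exists_equiv_siegelDeltaQuot_mulRight apply_siegelDeltaRat_mul)
open Summit.HodgeConjecture.HodgeConjecture.Cruxes.HLiu418.K2LiuDoublingUnfoldBridge
open Summit.HodgeConjecture.HodgeConjecture.Cruxes.HLiu418.K2LiuDoublingUnfoldTwist
open Summit.HodgeConjecture.HodgeConjecture.Cruxes.HLiu418.K2LiuDoublingUnfoldOrbit
open Summit.HodgeConjecture.HodgeConjecture.Cruxes.HLiu418.K2LiuDoublingUnfoldEngine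

section Majorant

variable (L : Type) [Field L] [NumberField L] [IsCMField L]
variable {N M n : ℕ} (e : Fin N × Fin M ≃ Fin n)
  (dV : Fin N → L) (hdV : ∀ i, IsCMField.complexConj L (dV i) = dV i)
  (dW : Fin M → L) (hdW : ∀ i, IsCMField.complexConj L (dW i) = dW i)

/-! ## §1 The Eisenstein majorant is bounded on compacta -/

/-- **THE EISENSTEIN MAJORANT OF A CONTINUOUS SECTION IS BOUNDED ON COMPACTA** (real form, all Godement data discharged): for `dV, dW ≠ 0`, a unitary
`χ`, `Re s > n/2` and a continuous Siegel section `f ∈ I_Δ(s, χ)`, on every compact `K' ⊆ H(𝔸)` the series `Σ_{γ ∈ P_Δ(L⁺)\H(L⁺)} ‖f(γ x)‖` is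
bounded by a constant.  (★ `tsum_enorm_translate_le_on_compact` fed with a Haar measure on `H(𝔸)`, ★ `iwasawaDatumNonempty`, ★
`exists_siegelHeight_continuous`, ★ `exists_isCoveringWeight_siegelDeltaRat` and ★ `parabolicIntegral`, then `ℝ≥0∞ → ℝ`.)
[cite: MoeglinWaldspurger1995, II.1.5] [cite: Liu2021, Lem. B.10 (2) p. 102] -/
theorem tsum_norm_translate_le_on_compact (hdV0 : ∀ i, dV i ≠ 0) (hdW0 : ∀ i, dW i ≠ 0)
    {χ : HeckeCharacter L} (hχ : χ.IsUnitary) {s : ℂ} (hs : (n : ℝ) / 2 < s.re)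
    {f : HA L e dV hdV dW hdW → ℂ} (hf : IsSiegelDeltaSection L e dV hdV dW hdW χ s f) (hfc : Continuous f)
    {K' : Set (HA L e dV hdV dW hdW)} (hK' : IsCompact K') :
    ∃ C : ℝ, ∀ x ∈ K', (∑' q : SiegelDeltaQuot L e dV hdV dW hdW,
      ‖f (((Quotient.out q : ratH L e dV hdV dW hdW) : HA L e dV hdV dW hdW) * x)‖) ≤ C := by
  -- Borel structure and a Haar measure on `H(𝔸)`
  letI : MeasurableSpace (HA L e dV hdV dW hdW) := borel _
  haveI : BorelSpace (HA L e dV hdV dW hdW) := ⟨rfl⟩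
  let μ : Measure (HA L e dV hdV dW hdW) := Measure.haar
  -- the Iwasawa datum and the continuous height of record
  obtain ⟨𝒦⟩ := iwasawaDatumNonempty L e dV hdV hdV0 dW hdW hdW0
  obtain ⟨Φ, hΦc, hΦpos, hΦ, hΦK, hΦfloor⟩ := exists_siegelHeight_continuous L e dV hdV dW hdW hdV0 hdW0
  have hΦm : Measurable Φ := hΦc.measurable
  have hτ : 2 * (n : ℝ) < 2 * s.re + (n : ℝ) := two_mul_lt_two_mul_re_add hs
  have hτ0 : 0 ≤ 2 * s.re + (n : ℝ) := (two_mul_re_add_pos (n := n) hs).le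
  -- Godement: (E5′) ⇒ E5
  obtain ⟨β', hβ'⟩ := exists_isCoveringWeight_siegelDeltaRat L e dV hdV dW hdW
  obtain ⟨μP, hμP, w₁, hw₁, hE5P⟩ := parabolicIntegral L e dV hdV dW hdW hdV0 hdW0 (2 * s.re + (n : ℝ)) hτ
  have hE5 := lintegral_siegelDomain_ne_top_of_parabolic L e dV hdV dW hdW μ 𝒦 hΦm hΦpos hΦ hΦK
    (upper_bound_of_floor L e dV hdV dW hdW hΦfloor) hτ0 μP hw₁ hE5P hβ'
  -- the majorant is bounded on `K'` in `ℝ≥0∞`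
  obtain ⟨C', hC', hb⟩ := tsum_enorm_translate_le_on_compact L e dV hdV dW hdW μ hχ hτ0 hf hfc 𝒦.isCompact_K 𝒦.iwasawa
    hΦm hΦpos hΦ hΦK hΦfloor hβ' hE5 hK'
  refine ⟨C'.toReal, fun x hx => ?_⟩
  have hfin : ∀ q : SiegelDeltaQuot L e dV hdV dW hdW,
      ‖f (((Quotient.out q : ratH L e dV hdV dW hdW) : HA L e dV hdV dW hdW) * x)‖ₑ ≠ ∞ := fun _ => enorm_ne_top
  have heq : (∑' q : SiegelDeltaQuot L e dV hdV dW hdW, ‖f (((Quotient.out q : ratH L e dV hdV dW hdW) : HA L e dV hdV dW hdW) * x)‖) =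
      (∑' q : SiegelDeltaQuot L e dV hdV dW hdW,
        ‖f (((Quotient.out q : ratH L e dV hdV dW hdW) : HA L e dV hdV dW hdW) * x)‖ₑ).toReal := by
    rw [ENNReal.tsum_toReal_eq hfin]
    exact tsum_congr fun q => (toReal_enorm _).symm
  rw [heq]
  exact ENNReal.toReal_mono hC' (hb x hx)

/-! ## §2 Left `H(L⁺)`-invariance and measurability of the majorant -/

/-- **The majorant is left-`H(L⁺)`-invariant**: `Σ_q ‖f(γ_q (γ h))‖ = Σ_q ‖f(γ_q h)‖` for `γ ∈ H(L⁺)` — right multiplication by `γ` permutes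
`P_Δ(L⁺)\H(L⁺)` (★ `exists_equiv_siegelDeltaQuot_mulRight`), `tsum` is blind to re-indexing (no convergence used), and `‖f(p y)‖ = ‖f(y)‖` for
rational Siegel `p` (★ `apply_siegelDeltaRat_mul`). [cite: Liu2021, §B.3 p. 101] [cite: MoeglinWaldspurger1995, II.1.5] -/
theorem tsum_norm_translate_ratH_mul {χ : HeckeCharacter L} {s : ℂ} {f : HA L e dV hdV dW hdW → ℂ}
    (hf : IsSiegelDeltaSection L e dV hdV dW hdW χ s f) (γ : ratH L e dV hdV dW hdW) (h : HA L e dV hdV dW hdW) :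
    (∑' q : SiegelDeltaQuot L e dV hdV dW hdW,
      ‖f (((Quotient.out q : ratH L e dV hdV dW hdW) : HA L e dV hdV dW hdW) * ((γ : HA L e dV hdV dW hdW) * h))‖) =
    ∑' q : SiegelDeltaQuot L e dV hdV dW hdW, ‖f (((Quotient.out q : ratH L e dV hdV dW hdW) : HA L e dV hdV dW hdW) * h)‖ := by
  obtain ⟨σ, hσ⟩ := exists_equiv_siegelDeltaQuot_mulRight L e dV hdV dW hdW γ
  rw [← Equiv.tsum_eq σ (fun q : SiegelDeltaQuot L e dV hdV dW hdW =>
    ‖f (((Quotient.out q : ratH L e dV hdV dW hdW) : HA L e dV hdV dW hdW) * h)‖)]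
  refine tsum_congr fun q => ?_
  have hq : σ q = Quotient.mk (MulAction.orbitRel (siegelDeltaRat L e dV hdV dW hdW) (ratH L e dV hdV dW hdW))
      (Quotient.out q * γ) := by
    conv_lhs => rw [← Quotient.out_eq q]
    exact hσ _
  have hrel : MulAction.orbitRel (siegelDeltaRat L e dV hdV dW hdW) (ratH L e dV hdV dW hdW)
      (Quotient.out (σ q)) (Quotient.out q * γ) :=
    Quotient.exact ((Quotient.out_eq (σ q)).trans hq)
  obtain ⟨p, hp⟩ := MulAction.mem_orbit_iff.1 (MulAction.orbitRel_apply.1 hrel)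
  rw [Subgroup.smul_def, smul_eq_mul] at hp
  rw [← hp, Subgroup.coe_mul, Subgroup.coe_mul, mul_assoc, mul_assoc, apply_siegelDeltaRat_mul L e dV hdV dW hdW hf p]

/-- `P_Δ(L⁺)\H(L⁺)` is countable (`H(L⁺)` is, ★ `countable_ratH`). [folklore] -/
theorem countable_siegelDeltaQuot : Countable (SiegelDeltaQuot L e dV hdV dW hdW) := by
  haveI : Countable (ratH L e dV hdV dW hdW) := countable_ratH L e dV hdV dW hdW
  unfold SiegelDeltaQuot
  infer_instance

/-- **The majorant is Borel measurable** on `H(𝔸)` for a continuous `f`: it is the `toReal` of the countable `ℝ≥0∞`-sum of the continuous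
functions `h ↦ ‖f(γ_q h)‖ₑ` (Mathlib `Measurable.ennreal_tsum`, `ENNReal.tsum_toReal_eq`). [folklore] -/
theorem measurable_tsum_norm_translate [MeasurableSpace (HA L e dV hdV dW hdW)] [BorelSpace (HA L e dV hdV dW hdW)]
    {f : HA L e dV hdV dW hdW → ℂ} (hfc : Continuous f) :
    Measurable fun h : HA L e dV hdV dW hdW => ∑' q : SiegelDeltaQuot L e dV hdV dW hdW,
      ‖f (((Quotient.out q : ratH L e dV hdV dW hdW) : HA L e dV hdV dW hdW) * h)‖ := by
  haveI := countable_siegelDeltaQuot L e dV hdV dW hdW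
  have hq : ∀ q : SiegelDeltaQuot L e dV hdV dW hdW, Measurable fun h : HA L e dV hdV dW hdW =>
      ‖f (((Quotient.out q : ratH L e dV hdV dW hdW) : HA L e dV hdV dW hdW) * h)‖ₑ := fun q =>
    (hfc.comp (continuous_const.mul continuous_id)).measurable.enorm
  have hE : Measurable fun h : HA L e dV hdV dW hdW => ∑' q : SiegelDeltaQuot L e dV hdV dW hdW,
      ‖f (((Quotient.out q : ratH L e dV hdV dW hdW) : HA L e dV hdV dW hdW) * h)‖ₑ := by
    simp_rw [ENNReal.tsum_eq_iSup_sum]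
    exact Measurable.iSup fun t => Finset.measurable_sum t fun q _ => hq q
  have heq : (fun h : HA L e dV hdV dW hdW => ∑' q : SiegelDeltaQuot L e dV hdV dW hdW,
      ‖f (((Quotient.out q : ratH L e dV hdV dW hdW) : HA L e dV hdV dW hdW) * h)‖) =
      fun h => (∑' q : SiegelDeltaQuot L e dV hdV dW hdW,
        ‖f (((Quotient.out q : ratH L e dV hdV dW hdW) : HA L e dV hdV dW hdW) * h)‖ₑ).toReal := by
    funext h
    rw [ENNReal.tsum_toReal_eq (fun _ => enorm_ne_top)]
    exact tsum_congr fun q => (toReal_enorm _).symm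
  rw [heq]
  exact hE.ennreal_toReal

end Majorant

/-! ## §3 The binder of ★ #13: the majorant kernel times continuous weights is integrable on `[G] × [G]` -/

/-- **ORGAN O1 OF #34 — THE `E(‖f‖)`-MAJORANT BINDER OF ★ #13 ON THE COMPACT QUOTIENT.**  In the frame of ★ `K2LiuDoublingUnfold.doublingUnfold`
(`W` of rank `1`, docking pin `hιA`, `[G]` compact, `μ` automorphic): for `dV, dW ≠ 0`, unitary `χ`, `Re s > n/2`, a continuous Siegel section
`f ∈ I_Δ(s, χ)` and continuous `φ₁ φ₂ : [G] → ℂ`,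
`x ↦ ‖E(‖f‖)(ι(ιA x̃₁⁻¹, ιA x̃₂⁻¹))‖ · ‖φ₁ x₁‖ · ‖φ₂ x₂‖` is `μ ⊗ μ`-integrable — the hypothesis of ★ #13 ∕ ★ `doublingUnfold_ae_twist` VERBATIM.
Bounded (§1 on the compact `ι(ιA A⁻¹ × ιA A⁻¹)`, `A` a compact set of representatives, §2 invariance) × measurable (§2 + ★ `measurable_of_comp_mk_prod`)
on a finite measure space. [cite: Liu2021, Lem. B.11 p. 102] [cite: MoeglinWaldspurger1995, II.1.5] [cite: GelbartPiatetskishapiroRallis1987, Part A §2] -/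
theorem integrable_majorant_mul :
    ∀ (L : Type) [Field L] [NumberField L] [IsCMField L] {N n : ℕ} (e : Fin N × Fin 1 ≃ Fin n)
      (H : Matrix (Fin N) (Fin N) L)
      (dV : Fin N → L) (hdV : ∀ i, IsCMField.complexConj L (dV i) = dV i)
      (dW : Fin 1 → L) (hdW : ∀ i, IsCMField.complexConj L (dW i) = dW i)
      (_hdV0 : ∀ i, dV i ≠ 0) (_hdW0 : ∀ i, dW i ≠ 0)
      (t : L) (_ht : t ≠ 0) (g : GL (Fin N) L)
      (_hg : formCongr ((IsCMField.complexConj L : L ≃ₐ[↥(maximalRealSubfield L)] L) : L →+* L) g (t • H) = Matrix.diagonal dV)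
      (μ : Measure (adelicGroupData (↥(maximalRealSubfield L)) L (IsCMField.complexConj L) N H).automorphicQuotient)
      [(adelicGroupData (↥(maximalRealSubfield L)) L (IsCMField.complexConj L) N H).IsAutomorphicMeasure μ]
      (ιA : (adelicGroupData (↥(maximalRealSubfield L)) L (IsCMField.complexConj L) N H).Adelic →*
        ↥(UnitaryGroup.adelic (↥(maximalRealSubfield L)) L (IsCMField.complexConj L) N (Matrix.diagonal dV))),
      (∀ k, ((ιA k : ↥(UnitaryGroup.adelic (↥(maximalRealSubfield L)) L (IsCMField.complexConj L) N (Matrix.diagonal dV))) :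
            GL (Fin N) (AdeleRing (𝓞 L) L)) =
          (toAdeleGL L g)⁻¹ * adelicVal (↥(maximalRealSubfield L)) L (IsCMField.complexConj L) N H k * toAdeleGL L g) →
      ∀ [CompactSpace (adelicGroupData (↥(maximalRealSubfield L)) L (IsCMField.complexConj L) N H).automorphicQuotient]
        (χ : HeckeCharacter L), χ.IsUnitary → ∀ (s : ℂ), (n : ℝ) / 2 < s.re →
        ∀ (f : HA L e dV hdV dW hdW → ℂ), IsSiegelDeltaSection L e dV hdV dW hdW χ s f → Continuous f →
        ∀ (φ₁ φ₂ : (adelicGroupData (↥(maximalRealSubfield L)) L (IsCMField.complexConj L) N H).automorphicQuotient → ℂ),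
          Continuous φ₁ → Continuous φ₂ →
          Integrable (fun x : (adelicGroupData (↥(maximalRealSubfield L)) L (IsCMField.complexConj L) N H).automorphicQuotient ×
                (adelicGroupData (↥(maximalRealSubfield L)) L (IsCMField.complexConj L) N H).automorphicQuotient =>
              ‖toQuotFun₂ (adelicGroupData (↥(maximalRealSubfield L)) L (IsCMField.complexConj L) N H)
                  (eisensteinPullback L e dV hdV dW hdW
                    (adelicGroupData (↥(maximalRealSubfield L)) L (IsCMField.complexConj L) N H) ιA
                    (fun h => ((‖f h‖ : ℝ) : ℂ))) x‖ * ‖φ₁ x.1‖ * ‖φ₂ x.2‖) (μ.prod μ) := by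
  intro L _ _ _ N n e H dV hdV dW hdW hdV0 hdW0 t ht g hg μ hμA ιA hιA _instC χ hχ s hs f hf hfc φ₁ φ₂ hφ₁ hφ₂
  -- ## instances on `G := U(H)(𝔸)`, `Γ := U(H)(L⁺)`, `[G] = G ⧸ Γ`
  haveI hT2 : T2Space (adelicGroupData (↥(maximalRealSubfield L)) L (IsCMField.complexConj L) N H).Adelic :=
    inferInstanceAs (T2Space (UnitaryGroup.adelic (↥(maximalRealSubfield L)) L (IsCMField.complexConj L) N H))
  haveI hLC : LocallyCompactSpace (adelicGroupData (↥(maximalRealSubfield L)) L (IsCMField.complexConj L) N H).Adelic :=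
    inferInstanceAs (LocallyCompactSpace (UnitaryGroup.adelic (↥(maximalRealSubfield L)) L (IsCMField.complexConj L) N H))
  haveI hSC : SecondCountableTopology (adelicGroupData (↥(maximalRealSubfield L)) L (IsCMField.complexConj L) N H).Adelic :=
    inferInstanceAs (SecondCountableTopology (UnitaryGroup.adelic (↥(maximalRealSubfield L)) L (IsCMField.complexConj L) N H))
  have hq : (adelicGroupData (↥(maximalRealSubfield L)) L (IsCMField.complexConj L) N H).quotientSubgroup =
      (adelicGroupData (↥(maximalRealSubfield L)) L (IsCMField.complexConj L) N H).arithmeticSubgroup := by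
    rw [AdelicGroupData.quotientSubgroup, show (adelicGroupData (↥(maximalRealSubfield L)) L (IsCMField.complexConj L) N H).center' = ⊥
      from rfl, bot_sup_eq]
  haveI hdisc : DiscreteTopology (adelicGroupData (↥(maximalRealSubfield L)) L (IsCMField.complexConj L) N H).quotientSubgroup := by
    rw [hq]
    exact UnitaryGroup.adelicGroupData_isDiscreteRational L N H
  have hΓc : IsClosed (((adelicGroupData (↥(maximalRealSubfield L)) L (IsCMField.complexConj L) N H).quotientSubgroup :
      Subgroup (adelicGroupData (↥(maximalRealSubfield L)) L (IsCMField.complexConj L) N H).Adelic) :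
      Set (adelicGroupData (↥(maximalRealSubfield L)) L (IsCMField.complexConj L) N H).Adelic) := Subgroup.isClosed_of_discrete
  letI : MeasurableSpace (adelicGroupData (↥(maximalRealSubfield L)) L (IsCMField.complexConj L) N H).Adelic := borel _
  haveI : BorelSpace (adelicGroupData (↥(maximalRealSubfield L)) L (IsCMField.complexConj L) N H).Adelic := ⟨rfl⟩
  letI : MeasurableSpace ((adelicGroupData (↥(maximalRealSubfield L)) L (IsCMField.complexConj L) N H).Adelic ⧸
      (adelicGroupData (↥(maximalRealSubfield L)) L (IsCMField.complexConj L) N H).quotientSubgroup) :=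
    (adelicGroupData (↥(maximalRealSubfield L)) L (IsCMField.complexConj L) N H).instMeasurableSpaceAutomorphicQuotient
  haveI : BorelSpace ((adelicGroupData (↥(maximalRealSubfield L)) L (IsCMField.complexConj L) N H).Adelic ⧸
      (adelicGroupData (↥(maximalRealSubfield L)) L (IsCMField.complexConj L) N H).quotientSubgroup) :=
    (adelicGroupData (↥(maximalRealSubfield L)) L (IsCMField.complexConj L) N H).instBorelSpaceAutomorphicQuotient
  haveI : CompactSpace ((adelicGroupData (↥(maximalRealSubfield L)) L (IsCMField.complexConj L) N H).Adelic ⧸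
      (adelicGroupData (↥(maximalRealSubfield L)) L (IsCMField.complexConj L) N H).quotientSubgroup) := _instC
  haveI : IsFiniteMeasure (α := (adelicGroupData (↥(maximalRealSubfield L)) L (IsCMField.complexConj L) N H).Adelic ⧸
      (adelicGroupData (↥(maximalRealSubfield L)) L (IsCMField.complexConj L) N H).quotientSubgroup) μ := hμA.toIsFiniteMeasure
  -- Borel structure on `H(𝔸)` (for §2)
  letI : MeasurableSpace (HA L e dV hdV dW hdW) := borel _
  haveI : BorelSpace (HA L e dV hdV dW hdW) := ⟨rfl⟩
  -- ## `ιA` is continuous and maps `G(L⁺)` to rational points of `H`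
  have hιc : Continuous ιA := by
    obtain ⟨Φ, -, hΦ⟩ := exists_continuousMulEquiv_eq_iotaA L H dV t ht g hg ιA hιA
    have h : (ιA : _ → _) = Φ := funext fun x => (hΦ x).symm
    rw [h]
    exact Φ.continuous
  -- the majorant on `H(𝔸)` and the pulled-back kernel on `G × G`
  set E₀ : HA L e dV hdV dW hdW → ℝ := fun h => ∑' q : SiegelDeltaQuot L e dV hdV dW hdW,
      ‖f (((Quotient.out q : ratH L e dV hdV dW hdW) : HA L e dV hdV dW hdW) * h)‖ with hE₀_def
  have hE₀nn : ∀ h, 0 ≤ E₀ h := fun h => tsum_nonneg fun _ => norm_nonneg _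
  have hE₀inv : ∀ (γ : ratH L e dV hdV dW hdW) (h : HA L e dV hdV dW hdW), E₀ ((γ : HA L e dV hdV dW hdW) * h) = E₀ h :=
    fun γ h => tsum_norm_translate_ratH_mul L e dV hdV dW hdW hf γ h
  have hE₀m : Measurable E₀ := measurable_tsum_norm_translate L e dV hdV dW hdW hfc
  set ιι : (adelicGroupData (↥(maximalRealSubfield L)) L (IsCMField.complexConj L) N H).Adelic ×
      (adelicGroupData (↥(maximalRealSubfield L)) L (IsCMField.complexConj L) N H).Adelic → HA L e dV hdV dW hdW :=
    fun y => iotaV L e dV hdV dW hdW (ιA y.1⁻¹, ιA y.2⁻¹) with hιι_def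
  have hιιc : Continuous ιι :=
    (continuous_iotaV L e dV hdV dW hdW).comp ((hιc.comp (continuous_fst.inv)).prodMk (hιc.comp (continuous_snd.inv)))
  -- the kernel: value of `toQuotFun₂ (eisensteinPullback ιA ‖f‖)` is `E₀ ∘ ιι` at the `Quotient.out` representatives
  have hker : ∀ x : (adelicGroupData (↥(maximalRealSubfield L)) L (IsCMField.complexConj L) N H).automorphicQuotient ×
      (adelicGroupData (↥(maximalRealSubfield L)) L (IsCMField.complexConj L) N H).automorphicQuotient,
      toQuotFun₂ (adelicGroupData (↥(maximalRealSubfield L)) L (IsCMField.complexConj L) N H)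
          (eisensteinPullback L e dV hdV dW hdW (adelicGroupData (↥(maximalRealSubfield L)) L (IsCMField.complexConj L) N H) ιA
            (fun h => ((‖f h‖ : ℝ) : ℂ))) x =
        ((E₀ (ιι ((Quotient.out (x.1 : (adelicGroupData (↥(maximalRealSubfield L)) L (IsCMField.complexConj L) N H).Adelic ⧸
              (adelicGroupData (↥(maximalRealSubfield L)) L (IsCMField.complexConj L) N H).quotientSubgroup) : (adelicGroupData (↥(maximalRealSubfield L)) L (IsCMField.complexConj L) N H).Adelic),
            (Quotient.out (x.2 : (adelicGroupData (↥(maximalRealSubfield L)) L (IsCMField.complexConj L) N H).Adelic ⧸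
              (adelicGroupData (↥(maximalRealSubfield L)) L (IsCMField.complexConj L) N H).quotientSubgroup) : (adelicGroupData (↥(maximalRealSubfield L)) L (IsCMField.complexConj L) N H).Adelic))) : ℝ) : ℂ) := by
    intro x
    show eisensteinSeriesDelta L e dV hdV dW hdW (fun h => ((‖f h‖ : ℝ) : ℂ)) _ = _
    rw [eisensteinSeriesDelta, hE₀_def]
    dsimp only
    rw [Complex.ofReal_tsum]
  -- ## invariance: the lift of the kernel to `G × G` is `E₀ ∘ ιι`
  have hrat : ∀ {γ : (adelicGroupData (↥(maximalRealSubfield L)) L (IsCMField.complexConj L) N H).Adelic},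
      γ ∈ (adelicGroupData (↥(maximalRealSubfield L)) L (IsCMField.complexConj L) N H).quotientSubgroup →
      ∀ y₁ y₂ : (adelicGroupData (↥(maximalRealSubfield L)) L (IsCMField.complexConj L) N H).Adelic,
        E₀ (ιι (y₁ * γ, y₂)) = E₀ (ιι (y₁, y₂)) ∧ E₀ (ιι (y₁, y₂ * γ)) = E₀ (ιι (y₁, y₂)) := by
    intro γ hγ y₁ y₂
    have hγi : γ⁻¹ ∈ (adelicGroupData (↥(maximalRealSubfield L)) L (IsCMField.complexConj L) N H).quotientSubgroup := inv_mem hγ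
    -- `ι(ιA γ⁻¹, 1) ∈ H(L⁺)` and `ι(1, ιA γ⁻¹) = ι(ιA γ⁻¹, ιA γ⁻¹) · ι(ιA γ, 1) ∈ H(L⁺)`
    have h1 : iotaV L e dV hdV dW hdW (ιA γ⁻¹, 1) ∈ ratH L e dV hdV dW hdW := by
      have h := iotaLeft_iotaA_mem_ratH L e H dV hdV dW hdW t ht g hg ιA hιA hγi
      rwa [iotaLeft_apply] at h
    have h2 : iotaV L e dV hdV dW hdW (1, ιA γ⁻¹) ∈ ratH L e dV hdV dW hdW := by
      have hsplit : ((1 : ↥(UnitaryGroup.adelic (↥(maximalRealSubfield L)) L (IsCMField.complexConj L) N (Matrix.diagonal dV))), ιA γ⁻¹) =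
          (ιA γ⁻¹, ιA γ⁻¹) * (ιA γ, 1) := by
        ext <;> simp
      rw [hsplit, map_mul]
      refine Subgroup.mul_mem _ (iotaV_diag_iotaA_mem_ratH L e H dV hdV dW hdW t ht g hg ιA hιA hγi) ?_
      have h := iotaLeft_iotaA_mem_ratH L e H dV hdV dW hdW t ht g hg ιA hιA hγ
      rwa [iotaLeft_apply] at h
    refine ⟨?_, ?_⟩
    · have hfac : ιι (y₁ * γ, y₂) = iotaV L e dV hdV dW hdW (ιA γ⁻¹, 1) * ιι (y₁, y₂) := by
        simp only [hιι_def, mul_inv_rev, map_mul, ← map_mul (iotaV L e dV hdV dW hdW), Prod.mk_mul_mk, one_mul]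
      rw [hfac]
      exact hE₀inv ⟨_, h1⟩ _
    · have hfac : ιι (y₁, y₂ * γ) = iotaV L e dV hdV dW hdW (1, ιA γ⁻¹) * ιι (y₁, y₂) := by
        simp only [hιι_def, mul_inv_rev, map_mul, ← map_mul (iotaV L e dV hdV dW hdW), Prod.mk_mul_mk, one_mul]
      rw [hfac]
      exact hE₀inv ⟨_, h2⟩ _
  have hlift : ∀ y₁ y₂ : (adelicGroupData (↥(maximalRealSubfield L)) L (IsCMField.complexConj L) N H).Adelic,
      E₀ (ιι ((Quotient.out ((y₁ : (adelicGroupData (↥(maximalRealSubfield L)) L (IsCMField.complexConj L) N H).Adelic) : (adelicGroupData (↥(maximalRealSubfield L)) L (IsCMField.complexConj L) N H).Adelic ⧸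
              (adelicGroupData (↥(maximalRealSubfield L)) L (IsCMField.complexConj L) N H).quotientSubgroup) : (adelicGroupData (↥(maximalRealSubfield L)) L (IsCMField.complexConj L) N H).Adelic),
        (Quotient.out ((y₂ : (adelicGroupData (↥(maximalRealSubfield L)) L (IsCMField.complexConj L) N H).Adelic) : (adelicGroupData (↥(maximalRealSubfield L)) L (IsCMField.complexConj L) N H).Adelic ⧸
              (adelicGroupData (↥(maximalRealSubfield L)) L (IsCMField.complexConj L) N H).quotientSubgroup) : (adelicGroupData (↥(maximalRealSubfield L)) L (IsCMField.complexConj L) N H).Adelic))) = E₀ (ιι (y₁, y₂)) := by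
    intro y₁ y₂
    obtain ⟨k₁, hk₁⟩ := QuotientGroup.mk_out_eq_mul
      (adelicGroupData (↥(maximalRealSubfield L)) L (IsCMField.complexConj L) N H).quotientSubgroup y₁
    obtain ⟨k₂, hk₂⟩ := QuotientGroup.mk_out_eq_mul
      (adelicGroupData (↥(maximalRealSubfield L)) L (IsCMField.complexConj L) N H).quotientSubgroup y₂
    rw [hk₁, hk₂, (hrat k₁.2 y₁ (y₂ * k₂)).1, (hrat k₂.2 y₁ y₂).2]
  -- ## measurability of the kernel on `[G]²`
  set Ker : (adelicGroupData (↥(maximalRealSubfield L)) L (IsCMField.complexConj L) N H).automorphicQuotient ×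
      (adelicGroupData (↥(maximalRealSubfield L)) L (IsCMField.complexConj L) N H).automorphicQuotient → ℝ := fun x =>
    E₀ (ιι ((Quotient.out (x.1 : (adelicGroupData (↥(maximalRealSubfield L)) L (IsCMField.complexConj L) N H).Adelic ⧸
              (adelicGroupData (↥(maximalRealSubfield L)) L (IsCMField.complexConj L) N H).quotientSubgroup) : (adelicGroupData (↥(maximalRealSubfield L)) L (IsCMField.complexConj L) N H).Adelic),
      (Quotient.out (x.2 : (adelicGroupData (↥(maximalRealSubfield L)) L (IsCMField.complexConj L) N H).Adelic ⧸
              (adelicGroupData (↥(maximalRealSubfield L)) L (IsCMField.complexConj L) N H).quotientSubgroup) : (adelicGroupData (↥(maximalRealSubfield L)) L (IsCMField.complexConj L) N H).Adelic))) with hKer_def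
  have hKerm : Measurable Ker := by
    refine measurable_of_comp_mk_prod
      (adelicGroupData (↥(maximalRealSubfield L)) L (IsCMField.complexConj L) N H).quotientSubgroup hΓc ?_
    have hfun : (fun y : (adelicGroupData (↥(maximalRealSubfield L)) L (IsCMField.complexConj L) N H).Adelic ×
        (adelicGroupData (↥(maximalRealSubfield L)) L (IsCMField.complexConj L) N H).Adelic =>
          Ker ((y.1 : (adelicGroupData (↥(maximalRealSubfield L)) L (IsCMField.complexConj L) N H).Adelic ⧸
              (adelicGroupData (↥(maximalRealSubfield L)) L (IsCMField.complexConj L) N H).quotientSubgroup),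
            (y.2 : (adelicGroupData (↥(maximalRealSubfield L)) L (IsCMField.complexConj L) N H).Adelic ⧸
              (adelicGroupData (↥(maximalRealSubfield L)) L (IsCMField.complexConj L) N H).quotientSubgroup))) = E₀ ∘ ιι := by
      funext y
      exact hlift y.1 y.2
    rw [hfun]
    exact hE₀m.comp hιιc.measurable
  -- ## boundedness of the kernel on `[G]²`: representatives in a compact set
  obtain ⟨A, hA, hAsurj⟩ := WeilQuotient.exists_isCompact_image_mk_superset
    (H := (adelicGroupData (↥(maximalRealSubfield L)) L (IsCMField.complexConj L) N H).quotientSubgroup)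
    (isCompact_univ (X := (adelicGroupData (↥(maximalRealSubfield L)) L (IsCMField.complexConj L) N H).Adelic ⧸
      (adelicGroupData (↥(maximalRealSubfield L)) L (IsCMField.complexConj L) N H).quotientSubgroup))
  obtain ⟨C, hC⟩ := tsum_norm_translate_le_on_compact L e dV hdV dW hdW hdV0 hdW0 hχ hs hf hfc ((hA.prod hA).image hιιc)
  have hKerb : ∀ x, ‖Ker x‖ ≤ max C 0 := by
    intro x
    obtain ⟨a₁, ha₁, hx₁⟩ := hAsurj (Set.mem_univ (x.1 : (adelicGroupData (↥(maximalRealSubfield L)) L (IsCMField.complexConj L) N H).Adelic ⧸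
      (adelicGroupData (↥(maximalRealSubfield L)) L (IsCMField.complexConj L) N H).quotientSubgroup))
    obtain ⟨a₂, ha₂, hx₂⟩ := hAsurj (Set.mem_univ (x.2 : (adelicGroupData (↥(maximalRealSubfield L)) L (IsCMField.complexConj L) N H).Adelic ⧸
      (adelicGroupData (↥(maximalRealSubfield L)) L (IsCMField.complexConj L) N H).quotientSubgroup))
    have hval : Ker x = E₀ (ιι (a₁, a₂)) := by
      rw [hKer_def]
      dsimp only
      obtain ⟨x₁, x₂⟩ := x
      simp only at hx₁ hx₂
      rw [← hx₁, ← hx₂]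
      exact hlift a₁ a₂
    rw [hval, Real.norm_of_nonneg (hE₀nn _)]
    exact (hC _ ⟨(a₁, a₂), ⟨ha₁, ha₂⟩, rfl⟩).trans (le_max_left _ _)
  -- ## bounded weights
  obtain ⟨B₁, hB₁⟩ := (isCompact_univ (X := (adelicGroupData (↥(maximalRealSubfield L)) L (IsCMField.complexConj L) N H).automorphicQuotient)).exists_bound_of_continuousOn
    hφ₁.continuousOn
  obtain ⟨B₂, hB₂⟩ := (isCompact_univ (X := (adelicGroupData (↥(maximalRealSubfield L)) L (IsCMField.complexConj L) N H).automorphicQuotient)).exists_bound_of_continuousOn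
    hφ₂.continuousOn
  -- ## the integrand is bounded and measurable on a finite measure space
  have hnorm : ∀ x : (adelicGroupData (↥(maximalRealSubfield L)) L (IsCMField.complexConj L) N H).automorphicQuotient ×
      (adelicGroupData (↥(maximalRealSubfield L)) L (IsCMField.complexConj L) N H).automorphicQuotient,
      ‖toQuotFun₂ (adelicGroupData (↥(maximalRealSubfield L)) L (IsCMField.complexConj L) N H)
          (eisensteinPullback L e dV hdV dW hdW (adelicGroupData (↥(maximalRealSubfield L)) L (IsCMField.complexConj L) N H) ιA
            (fun h => ((‖f h‖ : ℝ) : ℂ))) x‖ = Ker x := by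
    intro x
    rw [hker x, Complex.norm_real, Real.norm_of_nonneg (hE₀nn _)]
  have hmeas : AEStronglyMeasurable (fun x : (adelicGroupData (↥(maximalRealSubfield L)) L (IsCMField.complexConj L) N H).automorphicQuotient ×
        (adelicGroupData (↥(maximalRealSubfield L)) L (IsCMField.complexConj L) N H).automorphicQuotient =>
      ‖toQuotFun₂ (adelicGroupData (↥(maximalRealSubfield L)) L (IsCMField.complexConj L) N H)
          (eisensteinPullback L e dV hdV dW hdW (adelicGroupData (↥(maximalRealSubfield L)) L (IsCMField.complexConj L) N H) ιA
            (fun h => ((‖f h‖ : ℝ) : ℂ))) x‖ * ‖φ₁ x.1‖ * ‖φ₂ x.2‖) (μ.prod μ) := by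
    have h1 : AEStronglyMeasurable Ker (μ.prod μ) := hKerm.aestronglyMeasurable
    have h2 : AEStronglyMeasurable (fun x : (adelicGroupData (↥(maximalRealSubfield L)) L (IsCMField.complexConj L) N H).automorphicQuotient ×
        (adelicGroupData (↥(maximalRealSubfield L)) L (IsCMField.complexConj L) N H).automorphicQuotient => ‖φ₁ x.1‖) (μ.prod μ) :=
      (hφ₁.norm.measurable.comp measurable_fst).aestronglyMeasurable
    have h3 : AEStronglyMeasurable (fun x : (adelicGroupData (↥(maximalRealSubfield L)) L (IsCMField.complexConj L) N H).automorphicQuotient ×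
        (adelicGroupData (↥(maximalRealSubfield L)) L (IsCMField.complexConj L) N H).automorphicQuotient => ‖φ₂ x.2‖) (μ.prod μ) :=
      (hφ₂.norm.measurable.comp measurable_snd).aestronglyMeasurable
    refine ((h1.mul h2).mul h3).congr (Filter.Eventually.of_forall fun x => ?_)
    simp only [Pi.mul_apply, hnorm x]
  refine Integrable.of_bound (μ := μ.prod μ) hmeas (max C 0 * max B₁ 0 * max B₂ 0) (Filter.Eventually.of_forall fun x => ?_)
  rw [Real.norm_of_nonneg (mul_nonneg (mul_nonneg (norm_nonneg _) (norm_nonneg _)) (norm_nonneg _)), hnorm x]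
  have h1 : Ker x ≤ max C 0 := (Real.le_norm_self _).trans (hKerb x)
  have h2 : ‖φ₁ x.1‖ ≤ max B₁ 0 := (hB₁ x.1 (Set.mem_univ _)).trans (le_max_left _ _)
  have h3 : ‖φ₂ x.2‖ ≤ max B₂ 0 := (hB₂ x.2 (Set.mem_univ _)).trans (le_max_left _ _)
  have h0 : 0 ≤ Ker x := by rw [← hnorm x]; exact norm_nonneg _
  exact mul_le_mul (mul_le_mul h1 h2 (norm_nonneg _) (le_max_right _ _)) h3 (norm_nonneg _)
    (mul_nonneg (le_max_right _ _) (le_max_right _ _))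

end Summit.HodgeConjecture.HodgeConjecture.Cruxes.HLiu418.K2LiuDoublingZetaGL1Majorant

end
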